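import Summits.BirchSwinnertonDyer.Rank1Residual.X11b.VisibilityPair403280bd1
import Summits.BirchSwinnertonDyer.Rank1Residual.GaloisImage.MultiplicativeLocalTorsion
import Summits.BirchSwinnertonDyer.Rank1Residual.X11b.KrausMinimalityTwoUnit
import HarnessLib

/-!
# BSD rank-≤1 residual cell: `403280bd1 @ 5` — the gen-4 visibility certificate with the local
# binder `E'(ℚ_5)[5] = 0` PROVED in the kernel (gen 8)

HONEST FRAMING (cell `b2b-bsdres-*`, run/shared/lean/b2b/bsd-rank1-residual/, verbatim): the goal
of the cell is to DELETE the COMBINATION-SHAPED residual classes for ALL analytic-rank `≤ 1` elliptic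
curves over `ℚ` — "full BSD formula for every rank `≤ 1` curve in class C" assembled STRICTLY from
published theorems — so that the rank-`≤ 1` remainder becomes exactly the CONSTRUCTION-SHAPED
classes, which are TYPED (missing-input Props), NOT attempted; this is not "finishing BSD".
Unit `b2b-bsdres-x11c` (gen 8). Theorems only (no definition, no named fact). PER PAIR (a
certificate shape), not a class theorem; class X11b stays as labelled; the lane certifies the pair
and owns the verdict; nothing is booked by this file.

## What this file does

Gen 4 closed the unit's list-B pair `403280bd1 @ 5` (the only X11 ∧ r = 1 ∧ ¬sst pair with
`5 ∣ #Ш_an` below `5·10⁵`) per pair by Kolyvagin (upper half) + rank-3 VISIBILITY (lower half):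
`X11b.bsdp_v403280bd1`, whose local binder `hloc` asks `E'(ℚ_v)[5] = 0` for the partner
`E' = 403280a1` at every `v ∈ S = {2, 5, 71}` (two-engine certified, binder left to the lane).  The
partner has `5 ∥ N_{E'} = 2⁴·5·71²` with `ord_5 Δ_min(E') = 2`, `5 ∤ 2`, so at `v = 5` the binder is
the gen-8 kernel theorem
`GaloisImage.natCard_ker_nsmul_adicCompletion_eq_one_of_mult_of_not_dvd_padicValRat_j`
(`E'[5]^{I_5} = 0`: Serre 1972 §1.12, valuation half of the Kummer criterion).

* `bsdp_v403280bd1_of_mult` — the same certificate with `hloc` asked only at `v ∈ {2, 71}`.  KERNEL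
  in addition to gen 4's items: global minimality of the partner's Cremona model
  `[0, 0, 0, -37843, 2833042]` (bounded Kraus criterion with the `c₆ = 2⁶L`, `L ≡ 1 (4)` pattern at
  `2`: `ord₂ (c₄, c₆, Δ) = (4, 6, 17)`), `Mult E' 5` (`5 ∣ Δ`, `5 ∤ c₄`), `ord_5 Δ(E') = 2`.

References: [CremonaMazur2000] §3; [AgasheStein2002] Thm. 3.1; [McCallumLMS1991] §1;
[SerreInventiones1972] §1.12; [Kraus1989] Prop. 2; [SilvermanAEC2009] VII.1, VII.5.1; [Cremona2006].
-/

set_option autoImplicit false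

noncomputable section

open scoped Classical

open WeierstrassCurve Literature.NumberTheory.EllipticCurves
  Literature.NumberTheory.EllipticCurves.Rank1Residual
  Literature.NumberTheory.EllipticCurves.Rank1Residual.X11RankOneCertificates
  Summit.BirchSwinnertonDyer.BirchSwinnertonDyer.Rank1Residual.IntModel
  Summit.BirchSwinnertonDyer.BirchSwinnertonDyer.Rank1Residual.X11RankOne
  Summit.BirchSwinnertonDyer.Rank1Residual.GaloisImage
open NumberField IsDedekindDomain

namespace Summit.BirchSwinnertonDyer.Rank1Residual.X11b

/-- **`403280bd1 @ 5` — the visibility certificate `bsdp_v403280bd1` (gen 4) with the local binder at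
`v = 5` PROVED**: `hloc` is asked only at the places above `2` and `71`; at `5` the partner
`403280a1` is multiplicative with `ord_5 Δ_min = 2` (`5 ∤ 2`), so `E'(ℚ_5)[5] = 0` is the kernel
theorem `natCard_ker_nsmul_adicCompletion_eq_one_of_mult_of_not_dvd_padicValRat_j` (gen 8; partner
globally minimal by the bounded Kraus criterion with the `c₆ = 2⁶L`, `L ≡ 1 (4)` pattern,
multiplicative at `5` from `5 ∣ Δ`, `5 ∤ c₄`).  All other binders and their two-engine evidence
exactly as in `bsdp_v403280bd1`.  Per pair; nothing booked.
[cite: McCallumLMS1991, §1 Theorem (Kolyvagin), p. 296] [cite: CremonaMazur2000, §3 and Table 1]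
[cite: SerreInventiones1972, §1.12 (Cor. of Prop. 13)] -/
theorem bsdp_v403280bd1_of_mult (hCT : exists_casselsTate_pairing (K := ℚ))
    (hGZK : rank_eq_analyticRank_of_analyticRank_le_one)
    (W : WeierstrassCurve ℚ) (hW : W = ⟨0, -1, 0, 1908859, -1069809235⟩)
    {N : ℕ} [NeZero N] {K : Type} [Field K] [NumberField K] (hKo : kolyvagin N W K)
    (hB : Kolyvagin1990_padicValNat_card_sha_le N W K) (hK : IsImaginaryQuadratic K)
    (hH : SatisfiesHeegnerHypothesis N K) {P : (W.baseChange K).toAffine.Point}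
    (hP : IsHeegnerPoint N W K P) (hnt : ¬ IsOfFinAddOrder P)
    (hI : padicValNat 5 (AddSubgroup.zmultiples P).index ≤ 1)
    (hr : W.analyticRank = 1) {s : ℚ} (hs : shaAn W = (s : ℂ)) (hv : padicValRat 5 s = 2)
    (W' : WeierstrassCurve ℚ) (hW' : W' = ⟨0, 0, 0, -37843, 2833042⟩)
    (θ : geomTorsion W' (5 : ℕ) ≃+ geomTorsion W (5 : ℕ))
    (hθ : ∀ (σ : Field.absoluteGaloisGroup ℚ) (Q : geomTorsion W' (5 : ℕ)), θ (σ • Q) = σ • θ Q)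
    (hrank : 3 ≤ W'.mordellWeilRank)
    (hloc : ∀ v ∈ ({(Rat.HeightOneSpectrum.primesEquiv (R := 𝓞 ℚ)).symm ⟨2, Nat.prime_two⟩,
      (Rat.HeightOneSpectrum.primesEquiv (R := 𝓞 ℚ)).symm ⟨71, by norm_num⟩} :
        Finset (HeightOneSpectrum (𝓞 ℚ))),
      Nat.card (nsmulAddMonoidHom 5 : (W'.baseChange (v.adicCompletion ℚ)).toAffine.Point →+ _).ker = 1) :
    BSDp W 5 := by
  subst hW hW'
  haveI hE : (⟨0, -1, 0, 1908859, -1069809235⟩ : WeierstrassCurve ℚ).IsElliptic :=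
    isElliptic_of_discOf_ne_zero 0 (-1) 0 1908859 (-1069809235) (by decide +kernel)
  haveI hE' : (⟨0, 0, 0, -37843, 2833042⟩ : WeierstrassCurve ℚ).IsElliptic :=
    isElliptic_of_discOf_ne_zero 0 0 0 (-37843) 2833042 (by decide +kernel)
  haveI hM : (⟨0, -1, 0, 1908859, -1069809235⟩ : WeierstrassCurve ℚ).IsGloballyMinimal :=
    isGloballyMinimal_of_krausCriterion_bounded 0 (-1) 0 1908859 (-1069809235)
      (by decide +kernel) (by decide +kernel) (by decide +kernel)
  haveI : Fact (Nat.Prime 5) := ⟨by norm_num⟩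
  have hρ : Surj (⟨0, -1, 0, 1908859, -1069809235⟩ : WeierstrassCurve ℚ) 5 :=
    surj_v403280bd1 (integralModelInt_eq_of_map_eq _ (map_mk_int 0 (-1) 0 1908859 (-1069809235)))
  -- the partner: globally minimal, multiplicative at `5`, `ord_5 Δ = 2`
  haveI hM' : (⟨0, 0, 0, -37843, 2833042⟩ : WeierstrassCurve ℚ).IsGloballyMinimal :=
    X11b.isGloballyMinimal_of_krausCriterion_bounded₃ 0 0 0 (-37843) 2833042
      (by decide +kernel) (by decide +kernel) (by decide +kernel)
  have hI' : integralModelInt (⟨0, 0, 0, -37843, 2833042⟩ : WeierstrassCurve ℚ) =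
      (⟨0, 0, 0, -37843, 2833042⟩ : WeierstrassCurve ℤ) :=
    integralModelInt_eq_of_map_eq _ (map_mk_int 0 0 0 (-37843) 2833042)
  have hmult' : Mult (⟨0, 0, 0, -37843, 2833042⟩ : WeierstrassCurve ℚ) 5 :=
    hasMultiplicativeReductionAtPrime_of_intModel hI' 5 (by rw [intCurve_Δ]; decide +kernel)
      (by rw [intCurve_c₄]; decide +kernel)
  have hj' : ¬ ((5 : ℕ) : ℤ) ∣ padicValRat 5 (⟨0, 0, 0, -37843, 2833042⟩ : WeierstrassCurve ℚ).j := by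
    rw [← AdditivePotMult.dvd_padicValInt_minimalDiscriminantInt_iff_of_mult _ 5 hmult' 5,
      minimalDiscriminantInt_eq hI', padicValInt_eq_of_dvd_of_not_dvd 5 (e := 2)
        (by rw [intCurve_Δ]; decide +kernel) (by rw [intCurve_Δ]; decide +kernel)]
    decide
  refine bsdp_of_kolyvagin_of_congr _ 5 hCT hGZK hKo hB hK hH hP hnt (by norm_num) hρ hI hr hs hv _ θ hθ
    hrank _ (fun v hv' ↦ good_outside_v403280 v hv') (fun v hv5 ↦ ?_)
  rw [Finset.mem_insert, Finset.mem_insert, Finset.mem_singleton] at hv5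
  by_cases h5 : v = (Rat.HeightOneSpectrum.primesEquiv (R := 𝓞 ℚ)).symm ⟨5, by norm_num⟩
  · subst h5
    exact natCard_ker_nsmul_adicCompletion_eq_one_of_mult_of_not_dvd_padicValRat_j _ 5 (by norm_num)
      hmult' hj' (by rw [Equiv.apply_symm_apply])
  · refine hloc v ?_
    rw [Finset.mem_insert, Finset.mem_singleton]
    rcases hv5 with h | h | h
    · exact Or.inl h
    · exact absurd h h5
    · exact Or.inr h

end Summit.BirchSwinnertonDyer.Rank1Residual.X11b

end
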